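import Summits.BirchSwinnertonDyer.BirchSwinnertonDyer.Theorems.ErratumRoadFiveEulerHalfNotRamNoInertSetOfUB

/-!
# SECOND LINE «UB∃♭ᴮ» for crux `ErratumRoadFive.EulerHalfNotRamNoInertSetAtFive` (item stmt-BirchSwinnertonDyer-19715; the
# 404-pair residual of the Euler-system half after the inert re-key) — seat `bsd-stepL-bdp` g19, 2026-08-27; DELIVERED to the
# planner (HOME/bdp/lines-g19/), NOT registered by this seat (the registered decomposition of record is plan g26's `Lines/birth.lean`:
# `stub_res_pOnlyMultAtFive` ∕ `stub_res_otherMultAtFive` ∕ rung)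

Idea (PROOF-BDP §43 ∕ §45; kernel p524850 ∕ p525374 ∕ p525859 ∕ p526303, all `--supports 19715 --as helper`): the Euler-system
half `Typed.MissingUpperBoundAt W p` on EVERY ¬(ram) ∧ surj X11b pair at `p ≥ 5` — in particular on both registered pieces of
19715, with their extra binders unused — follows from ONE typed input, UB∃♭ᴮ|¬ram (the Euler-system inclusion
«`(L_𝔭) ⊆ Ch_Λ(X_ac 𝔭bar)·Λ`» of the BDP anticyclotomic main conjecture for `E` ITSELF at `p ∥ N`, at SOME integral frame carrying
Castella's interpolation property and the value at `𝟙`; = H∃♭ᴮ `P2.IMCDivIntFrameOnTreeB` with its last conjunct REVERSED), plus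
three items that are ALREADY binders of the route's `closes`: `PublishedInputsFive` (19066, h₅), `JSWAnticyclotomicControlMult`
(19626, h331), `X11aLowerHalf` (19064, h₃). Mechanism: UB ∘ value at `𝟙` ∘ JSW control identity ⟹ the SHARP bound
`ord_p #Ш(E∕K) + 2·ord_p ∏c(E) ≤ 2·ord_p[E(K):ℤP]` over the odd-`d_K` Heegner field (Tamagawa-INCLUSIVE — this is why no Shimura
curve, no inert set and no Tamagawa condition are needed), then the ℚ-descent with the twist's lower half from `X11aLowerHalf`.

Stubs (1 ≤ stubs_max): `stub_ubB_notRam` (DECIDING and ONLY stub; = the hypothesis `hUBnr` of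
`EulerHalfUB.eulerHalfNotRamNoInertSetAtFive_of_ubB_of_items` VERBATIM). Status of its content: NOT in print at any `p ∣ N` (lit g19
EPS3-SOURCES §E.1); MEMO-PROVED class-wide at `p ≥ 5` (X11b, ρ̄ onto, strict-Heegner K, d_K odd, D_K ∉ {−3,−4}, p ∤ h_K) in
HOME/proof/PROOF-BDP.md §38.8 ∕ §38.10 ∕ §39 (non-split) + §41 (split), REFEREE-PASSED (g44 VERDICT-BDP-S38; g45 VERDICT-BDP-S39 ∕ S41)
modulo the named grants S3 ∕ Lemma-5.5-slope ∕ G1. It is the SAME object as `stub_nr_ub` of the 19282 λ-matching line (there in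
`R₀`-currency, ∀-frames, `∃ k`; here 𝓞_{ℂ_p}-currency, ∃-frame with value, `k = 0` — the form the Euler half needs).
Composition `EulerHalfNotRamNoInertSetAtFive_of (h₅) (h331) (h₃) (hub)` concludes the ROUTE DECL BY NAME (sorry-free; one line over
p526303). HONEST FRAMING: sorries ONLY in `stub_ubB_notRam`; `X11aLowerHalf` is itself an OPEN crux (rung K6's object); nothing is
asserted about any curve; nothing booked (T7); BSD proved for no pair. Compared with the registered birth line: that line cuts by
the NUMBER of multiplicative primes and names per-piece techniques (𝓛-invariant ∕ level-raised Shimura curve ∕ mixed-field twist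
transport); this line is uniform over both pieces and needs no `p`-adic height (barrier `PAdicHeightNondegeneracy` not met) and no
Shimura curve — its single open input is an Iwasawa-theoretic divisibility.
-/

set_option linter.dupNamespace false
set_option autoImplicit false

noncomputable section

open scoped Classical NumberField

open WeierstrassCurve NumberField IsDedekindDomain Field PowerSeries
open Literature.NumberTheory.EllipticCurves
open Literature.NumberTheory.EllipticCurves.ModularForms
open Literature.NumberTheory.EllipticCurves.Rank1Residual
open Literature.NumberTheory.EllipticCurves.Rank1Residual.Typed
open Literature.NumberTheory.GaloisRepresentations Literature.NumberTheory.GaloisCohomology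
open Literature.NumberTheory.Automorphic
open Summit.BirchSwinnertonDyer.Rank1Residual Summit.BirchSwinnertonDyer.Rank1Residual.X11b
open Summit.BirchSwinnertonDyer.Rank1Residual.X11b.AcSelmer
open Summit.BirchSwinnertonDyer.BirchSwinnertonDyer.Theses.ErratumRoadFive

namespace Summit.BirchSwinnertonDyer.BirchSwinnertonDyer.Cruxes.EulerHalfNotRamNoInertSetAtFive.UbB

/-! ## Registered-form stub (sorry ONLY here) -/

/-- **STUB (DECIDING, the only one) · `stub_ubB_notRam` — UB∃♭ᴮ on the ¬(ram) X11b pairs:** at every classical Heegner datum of a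
¬(ram) pair (binders VERBATIM those of the oriented classical atoms), for every anticyclotomic `(κ, γ)`, embedding datum `ι'`, infinite
place `w₀`, point `P'` read as the Heegner point through `w₀` and embedding `e` inducing `𝔭_{ι'}`: an integral frame
`(Ω_K ≠ 0, ‖Ω_p‖ = 1, Q)` with Castella's interpolation property at `(ι', 𝔭_{ι'})`, the value `Q(𝟙) = u·((1 − a_p p⁻¹)·log_{ω_E} P')²`,
`‖u‖ = 1`, and for every prime `𝔭bar ∋ p`, `𝔭bar ≠ 𝔭_{ι'}`: `(Q) ⊆ Ch_Λ(X_ac^∅(E∕K_∞)_{𝔭bar})·𝓞_{ℂ_p}⟦T⟧`.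
Memo-proved class-wide at `p ≥ 5` (PROOF-BDP §38.8∕§38.10∕§39∕§41; referee-passed g44 + g45 mod grants); NOT in print at `p ∣ N`.
[cite: Castella2018, Thms. 2.3, 3.1, 3.2 (arXiv:1704.06608 pp. 5, 9) (shapes)] [cite: Castella2018Exceptional, Thms. 2.10–2.11]
[cite: Howard2004Compositio, Thm. B (the shape of UB at good p)] -/
theorem stub_ubB_notRam :
    ∀ (W : WeierstrassCurve ℚ) [W.IsElliptic] [W.IsGloballyMinimal] (p : ℕ) [Fact p.Prime],
        ¬ Ram W p →
        ∀ (N : ℕ) [NeZero N] (K : Type) [Field K] [NumberField K]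
        (Dt : ModularParametrizationData W N) (H : HeegnerDatum N (NumberField.discr K)) (ι : K →+* ℂ)
        (P : (W.baseChange K).toAffine.Point),
        ClassX11b W p → 5 ≤ p → Surj W p → W.conductorNorm ℤ = N → IsImaginaryQuadratic K →
        Odd (NumberField.discr K) → ¬ (p : ℤ) ∣ NumberField.discr K → ¬ p ∣ Units.torsionOrder K →
        SatisfiesHeegnerHypothesis N K →
        (W.quadraticTwist (NumberField.discr K : ℚ)).entireLFunction 1 ≠ 0 →
        WeierstrassCurve.Affine.Point.map ι.toRatAlgHom P = heegnerPointComplex Dt H →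
        ¬ (p : ℤ) ∣ Dt.c → ¬ IsOfFinAddOrder P →
        ∀ (κ : ZpExtension K p), κ.IsAnticyclotomic →
          ∀ (γ : Field.absoluteGaloisGroup K) [Fact (κ.IsTopGenerator γ)]
            (ι' : PadicAlgCl p ≃+* ℂ) (w₀ : InfinitePlace K) (P' : (W.baseChange K).toAffine.Point),
            WeierstrassCurve.Affine.Point.map w₀.embedding.toRatAlgHom P' = heegnerPointComplex Dt H →
            ∀ (e : K →+* ℚ_[p]),
              (∀ k : 𝓞 K, k ∈ (primeOfEmbeddingDatum p ι' w₀.embedding).asIdeal ↔ ‖e (k : K)‖ < 1) →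
              ∃ (ΩK : ℂ) (Ωp : ℂ_[p]) (Q : PowerSeries 𝓞_ℂ_[p]), ΩK ≠ 0 ∧ ‖Ωp‖ = 1 ∧
                R1.IsBDPLFunctionInt p ι' (primeOfEmbeddingDatum p ι' w₀.embedding) κ γ Dt.f ΩK Ωp Q ∧
                R1.BDPValueAtOneIntAt W p e P' Q (W.LFunction p) ∧
                ∀ (𝔭bar : HeightOneSpectrum (𝓞 K)), ((p : ℕ) : 𝓞 K) ∈ 𝔭bar.asIdeal →
                  𝔭bar ≠ primeOfEmbeddingDatum p ι' w₀.embedding →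
                  Ideal.span {Q} ≤
                    (XAc.charIdeal (W.baseChange K) p κ 𝔭bar ∅ γ).map (PowerSeries.map (R1.toCpInt p)) := by
  sorry

/-! ## Stub statement by name -/

namespace Statement

/-- Statement of `stub_ubB_notRam`. -/
abbrev stub_ubB_notRam : Prop := type_of% @UbB.stub_ubB_notRam

end Statement

/-! ## The composition (sorry-free): the stub STATEMENT + three `closes` binders imply the crux, BY NAME -/

/-- **`EulerHalfNotRamNoInertSetAtFive_of`** — the crux BY NAME from `PublishedInputsFive` (item 19066), `JSWAnticyclotomicControlMult`
(19626), `X11aLowerHalf` (19064) — all three binders of the route's `closes` — and the ONE stub, through bdp g19's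
`EulerHalfUB.eulerHalfNotRamNoInertSetAtFive_of_ubB_of_items` (p526303). Pure composition. -/
theorem EulerHalfNotRamNoInertSetAtFive_of (h₅ : PublishedInputsFive) (h331 : JSWAnticyclotomicControlMult)
    (h₃ : X11aLowerHalf) (hub : Statement.stub_ubB_notRam) :
    Summit.BirchSwinnertonDyer.BirchSwinnertonDyer.Theses.ErratumRoadFive.EulerHalfNotRamNoInertSetAtFive :=
  Summit.BirchSwinnertonDyer.BirchSwinnertonDyer.Theorems.EulerHalfUB.eulerHalfNotRamNoInertSetAtFive_of_ubB_of_items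
    h₅ h331 h₃ hub

/-- The crux along this line, MODULO exactly the one stub (and the three route items it is handed). -/
theorem EulerHalfNotRamNoInertSetAtFive_proof (h₅ : PublishedInputsFive) (h331 : JSWAnticyclotomicControlMult)
    (h₃ : X11aLowerHalf) :
    Summit.BirchSwinnertonDyer.BirchSwinnertonDyer.Theses.ErratumRoadFive.EulerHalfNotRamNoInertSetAtFive :=
  EulerHalfNotRamNoInertSetAtFive_of h₅ h331 h₃ stub_ubB_notRam

end Summit.BirchSwinnertonDyer.BirchSwinnertonDyer.Cruxes.EulerHalfNotRamNoInertSetAtFive.UbB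

end
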